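import Literature.NumberTheory.LFunctions.RudnickSarnakThm41Proofs
import HarnessLib

/-!
# Rudnick–Sarnak §4 for `ζ`: discharge of the sieving fact

Z. Rudnick, P. Sarnak, *Zeros of principal `L`-functions and random matrix theory*, Duke Math.
J. **81** (1996), 269–322, §4 (pp. 304–316). The named fact
`Literature.NumberTheory.LFunctions.rudnick_sarnak_sieving` (`RudnickSarnak.lean`:
`RH → RSUnrestrictedLimits → RSRestrictedLimits`, "Theorem 3.2 at every level implies the
`T`-indexed Theorem 1.2 for every admissible `f_Φ`") is the conjunction of three printed steps:
the Möbius sieving (4.5)–(4.9) over the partition lattice `Π_n` (proved,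
`RudnickSarnakSieving.lean`), the pull-back `ι_F^* f_Φ = f_{Φ_F}` (4.14) (proved,
`RudnickSarnakPullback.lean`), and Theorem 4.1 with Lemma 4.1 ((4.13)–(4.16)), recorded as the
named fact `rudnick_sarnak_thm41` (`RudnickSarnakThm41.lean`) and discharged by
`rudnick_sarnak_thm41_holds` (`RudnickSarnakThm41Proofs.lean`: Props. 4.1–4.3, Lemmas 4.2–4.3,
Spitzer's identity). The reduction `rudnick_sarnak_sieving_of_thm41` is proved in
`RudnickSarnakThm41.lean`; this file only records the closed discharge. (It cannot live in
`RudnickSarnak.lean` itself: `RudnickSarnakThm41Proofs` imports it.)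

## References

* Z. Rudnick, P. Sarnak, Duke Math. J. 81 (1996), 269–322: §4, Lemma 4.1, (4.9), (4.13)–(4.16),
  Theorem 4.1 (p. 307), Props. 4.1–4.3.
-/

namespace Literature.NumberTheory.LFunctions

/-- **Discharge of `rudnick_sarnak_sieving`** (Rudnick–Sarnak 1996, §4 for `L = ζ`): under RH,
the conclusion of Theorem 3.2 at all levels (`RSUnrestrictedLimits`) implies the `T`-indexed
Theorem 1.2 for every admissible `f_Φ` (`RSRestrictedLimits`). Proof:
`rudnick_sarnak_sieving_of_thm41` (Möbius sieving (4.9), pull-back (4.14), Theorem 3.2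
termwise, (4.15)–(4.16)) applied to the proved Theorem 4.1, `rudnick_sarnak_thm41_holds`.
[cite: RudnickSarnak1996, §4: Lemma 4.1, (4.9), (4.15)–(4.16), Thm 4.1] -/
theorem rudnick_sarnak_sieving_holds : rudnick_sarnak_sieving :=
  rudnick_sarnak_sieving_of_thm41 rudnick_sarnak_thm41_holds

end Literature.NumberTheory.LFunctions
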